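import Literature.Probability.FitznerVanDerHofstad2017.NobleNSumSlices
import Literature.Probability.FitznerVanDerHofstad2017.NobleKSpaceRewritePhi
import HarnessLib

/-!
# [NoBLE17] Assumption 4.3 (4.31)–(4.33): the twenty-two `N`-sum rows AT THE TYPED STAGE-1 RECORD WITH TAILS — PROVED glue

Source of the target shape: R. Fitzner, R. van der Hofstad, *Generalized approach to the non-backtracking lace
expansion*, Probab. Theory Relat. Fields **169** (2017) 1041–1119 [NoBLE17], Assumption 4.3, p. 1086:
(4.31) "`Σ_N Ξ̂^{(N)}(0) ≤ β^{abs}_Ξ`, `Σ_N Ξ̂^{(N),ι}(0) ≤ β^{abs}_{Ξ^ι}`", (4.32) "`Σ_N Σ_x ‖x‖₂² Ξ^{(N)}(x) ≤ β^{abs}_{ΔΞ}`,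
`Σ_N Σ_x ‖x‖₂² Ξ^{(N),ι}(x) ≤ β^{abs}_{ΔΞ^ι,0}`", (4.33) "`Σ_N Σ_x ‖x − e_ι‖₂² Ξ^{(N),ι}(x) ≤ β^{abs}_{ΔΞ^ι,ι}`", with the
even / odd / tail splittings of App. D (p. 1110), as typed in `NobleAssumptions.NobleAssumption43At` (fields `xiAbs`,
`xiOdd`, `xiEven`, `xiEvenTail`, `xiOddTail`; `xiDeltaAbs`, …, `xiEvenTailDelta`; `xiIotaAbs`, …, `xiIotaEvenTail`;
`xiIotaDeltaZero`, …; `xiIotaDeltaEi`, …: twenty-two `NSumLE` rows).  Source of the constants: R. Fitzner,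
R. van der Hofstad, *Mean-field behavior for nearest-neighbor percolation in `d > 10`*, EJP **22** (2017) no. 43
[FvdH17], notebook `Percolation.nb` [FvdHnb] cell 43 (transcript HOME/b2b-lace-num3/published/Percolation.txt
l.1183–1189: "`Bound[Xi,Even,s] = Bound[Xi,0,s] + Bound[Xi,EvenTail,s]`", "`Bound[Xi,Odd,s] = Bound[Xi,1,s] +
Bound[Xi,OddTail,s]`", "`Bound[Xi,Absolut,s] = Bound[Xi,Odd,s] + Bound[Xi,Even,s]`", likewise for the `Delta` and `ι`
families) and cell 44 (l.1214–1237, the App. D input record), typed as `Stage1Tails.inpFull D y s` = the tail-free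
record `Stage1Cells.Data.inp` (cells as positive expressions, `Stage1Cells`) plus the `N ≥ 4` tail tables of cells 41–42
read as series (`Stage1Tails.tailVal Reading.series`).

What this module proves (kernel-checked; d-generic; abstract over the typed data `D : Stage1Cells.Data ν`, the state
`y`, the point `s` and over the FAMILY `Ξ : ℕ → Site d → ℝ` being summed — no percolation quantity, no numeral, nothing
cited as a hypothesis):
* `inpT_xiEven`, …, `inpT_xiIotaEvenTailDeltaEi` — the twenty-two tail-carrying fields of `Stage1Tails.inpT Φ D y s`
  unfolded to "explicit cells + table value" (`rfl` lemmas: e.g. `(inpT Φ D y s).xiEven = D.ev s y (Xi0 D.P) +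
  D.ev s y (Xi2 D.P) + tailVal (Φ s) D y s Tail.xiEven`);
* `record_xi_rows` — for a non-negative family `Ξ` with the four cells `SumLE (Ξ N) (D.ev s y (Xi_N D.P))`, `N ≤ 3`,
  the Neumann certificate `(1 − B(s)²)S = 1`, `S ≥ 0` at the point, and the per-`N` bounds
  `Σ_x Ξ_N(x) ≤ P^S B^{N−1} Ā P^E` (`N ≥ 4`, [FvdH17] Prop. 5.5 (5.34) in the record's block coordinates
  `Stage1Tails.ingr D s y`), the five rows `xiEven`, `xiOdd`, `xiEvenTail`, `xiOddTail`, `xiAbs` of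
  `NobleAssumption43At … (inpFull D y s)` hold for `Ξ` (via `NobleNSums.NSumLE_rows_of_bounds` and the interleaving
  `NSumLE_of_even_odd` of the module `NobleKSpaceRewritePhi`);
* `record_xiDelta_rows` — the same for a weighted family from the four `Delta` cells and per-`j` SLICE bounds against
  the tables `Tail.xiEvenDelta` (`N = 2j+4`) / `Tail.xiOddDelta` (`N = 2j+5`) (`NobleNSums.NSumLE_weightedRows_of_sliceBounds`;
  the slices are expanded in the print's coordinates by `NobleNSumSliceTables.totalSlice_xiEvenDelta` etc.);
* `record_xiIota_rows`, `record_xiIotaDeltaZero_rows`, `record_xiIotaDeltaEi_rows` — the `ι`-families (one `ι` at a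
  time; the cells do not depend on `ι`).
So the per-`N` owners' TARGET CURRENCY at the record is fixed: cells in `SumLE` form against `D.ev s y (…)`, tails in
the matrix form of (5.34)/(5.37) resp. in slice form against `totalSlice (ingr D s y) Tail.…`.  The majorant record
`inpMaj` follows by `Stage1Tails.inpFull_dom_inpMaj` (field-wise `≤`).  NOT here: any per-`N` bound, any cell bound,
the split `S` or the remaining (non-`N`-sum) fields of Assumption 4.3.

## References
* [NoBLE17] PTRF 169 (2017): Assumption 4.3 (4.31)–(4.33) (p. 1086); App. D (p. 1110).
* [FvdH17] arXiv:1506.07977v2: Prop. 5.5 (5.34)–(5.36), Prop. 5.6 (5.37)–(5.41) (p. 53); Remark 2.3 (pp. 12–13).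
* [FvdHnb] `Percolation.nb` cells 41–44 (transcript l.1131–1237).
-/

noncomputable section

namespace Literature.Probability.FitznerVanDerHofstad2017.NobleNSums

open Finset
open Literature.Probability.LatticeModels Literature.Probability.Percolation
open Literature.Probability.FitznerVanDerHofstad2017 Stage1Tails EigenTails Stage1Cells NoGoFrame BetaMap
open scoped BigOperators Matrix

/-! ## The tail-carrying fields of `inpT Φ D y s`, unfolded -/

section Fields

variable {ν : Type*} (Φ : Pt → Reading (Fin 3)) (D : Data ν) (y : State) (s : Pt)

/-- `xiAbs = (Bound[Xi,1] + Bound[Xi,3]) + (Bound[Xi,0] + Bound[Xi,2]) + (odd tail + even tail)`. [cite: FitznerVanDerHofstad2017, notebook Percolation.nb cells 43–44 (transcript l.1183–1237)] -/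
theorem inpT_xiAbs : (inpT Φ D y s).xiAbs = D.ev s y (Xi1 D.P) + D.ev s y (Xi3 D.P)
    + (D.ev s y (Xi0 D.P) + D.ev s y (Xi2 D.P))
    + (tailVal (Φ s) D y s Tail.xiOdd + tailVal (Φ s) D y s Tail.xiEven) := rfl

/-- `xiOdd = Bound[Xi,1] + Bound[Xi,3] + odd tail`. [cite: FitznerVanDerHofstad2017, notebook Percolation.nb cells 43–44 (transcript l.1183–1237)] -/
theorem inpT_xiOdd : (inpT Φ D y s).xiOdd =
    D.ev s y (Xi1 D.P) + D.ev s y (Xi3 D.P) + tailVal (Φ s) D y s Tail.xiOdd := rfl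

/-- `xiEven = Bound[Xi,0] + Bound[Xi,2] + even tail`. [cite: FitznerVanDerHofstad2017, notebook Percolation.nb cells 43–44 (transcript l.1183–1237)] -/
theorem inpT_xiEven : (inpT Φ D y s).xiEven =
    D.ev s y (Xi0 D.P) + D.ev s y (Xi2 D.P) + tailVal (Φ s) D y s Tail.xiEven := rfl

/-- `xiEvenTail = Bound[Xi,2] + even tail`. [cite: FitznerVanDerHofstad2017, notebook Percolation.nb cells 43–44 (transcript l.1183–1237)] -/
theorem inpT_xiEvenTail : (inpT Φ D y s).xiEvenTail = D.ev s y (Xi2 D.P) + tailVal (Φ s) D y s Tail.xiEven := rfl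

/-- `xiOddTail = Bound[Xi,3] + odd tail`. [cite: FitznerVanDerHofstad2017, notebook Percolation.nb cells 43–44 (transcript l.1183–1237)] -/
theorem inpT_xiOddTail : (inpT Φ D y s).xiOddTail = D.ev s y (Xi3 D.P) + tailVal (Φ s) D y s Tail.xiOdd := rfl

/-- `xiDeltaAbs`, unfolded. [cite: FitznerVanDerHofstad2017, notebook Percolation.nb cells 43–44 (transcript l.1183–1237)] -/
theorem inpT_xiDeltaAbs : (inpT Φ D y s).xiDeltaAbs = D.ev s y (Xi1D D.P) + D.ev s y (Xi3D D.P)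
    + (D.ev s y (Xi0D D.P) + D.ev s y (Xi2D D.P))
    + (tailVal (Φ s) D y s Tail.xiOddDelta + tailVal (Φ s) D y s Tail.xiEvenDelta) := rfl

/-- `xiOddDelta`, unfolded. [cite: FitznerVanDerHofstad2017, notebook Percolation.nb cells 43–44 (transcript l.1183–1237)] -/
theorem inpT_xiOddDelta : (inpT Φ D y s).xiOddDelta =
    D.ev s y (Xi1D D.P) + D.ev s y (Xi3D D.P) + tailVal (Φ s) D y s Tail.xiOddDelta := rfl

/-- `xiEvenDelta`, unfolded. [cite: FitznerVanDerHofstad2017, notebook Percolation.nb cells 43–44 (transcript l.1183–1237)] -/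
theorem inpT_xiEvenDelta : (inpT Φ D y s).xiEvenDelta =
    D.ev s y (Xi0D D.P) + D.ev s y (Xi2D D.P) + tailVal (Φ s) D y s Tail.xiEvenDelta := rfl

/-- `xiOddTailDelta`, unfolded. [cite: FitznerVanDerHofstad2017, notebook Percolation.nb cells 43–44 (transcript l.1183–1237)] -/
theorem inpT_xiOddTailDelta : (inpT Φ D y s).xiOddTailDelta =
    D.ev s y (Xi3D D.P) + tailVal (Φ s) D y s Tail.xiOddDelta := rfl

/-- `xiEvenTailDelta`, unfolded. [cite: FitznerVanDerHofstad2017, notebook Percolation.nb cells 43–44 (transcript l.1183–1237)] -/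
theorem inpT_xiEvenTailDelta : (inpT Φ D y s).xiEvenTailDelta =
    D.ev s y (Xi2D D.P) + tailVal (Φ s) D y s Tail.xiEvenDelta := rfl

/-- `xiIotaAbs`, unfolded. [cite: FitznerVanDerHofstad2017, notebook Percolation.nb cells 43–44 (transcript l.1183–1237)] -/
theorem inpT_xiIotaAbs : (inpT Φ D y s).xiIotaAbs = D.ev s y (XiIota1 D.P) + D.ev s y (XiIota3 D.P)
    + (D.ev s y (XiIota0 D.P) + D.ev s y (XiIota2 D.P))
    + (tailVal (Φ s) D y s Tail.xiIotaOdd + tailVal (Φ s) D y s Tail.xiIotaEven) := rfl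

/-- `xiIotaOdd`, unfolded. [cite: FitznerVanDerHofstad2017, notebook Percolation.nb cells 43–44 (transcript l.1183–1237)] -/
theorem inpT_xiIotaOdd : (inpT Φ D y s).xiIotaOdd =
    D.ev s y (XiIota1 D.P) + D.ev s y (XiIota3 D.P) + tailVal (Φ s) D y s Tail.xiIotaOdd := rfl

/-- `xiIotaEven`, unfolded. [cite: FitznerVanDerHofstad2017, notebook Percolation.nb cells 43–44 (transcript l.1183–1237)] -/
theorem inpT_xiIotaEven : (inpT Φ D y s).xiIotaEven =
    D.ev s y (XiIota0 D.P) + D.ev s y (XiIota2 D.P) + tailVal (Φ s) D y s Tail.xiIotaEven := rfl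

/-- `xiIotaEvenTail`, unfolded. [cite: FitznerVanDerHofstad2017, notebook Percolation.nb cells 43–44 (transcript l.1183–1237)] -/
theorem inpT_xiIotaEvenTail : (inpT Φ D y s).xiIotaEvenTail =
    D.ev s y (XiIota2 D.P) + tailVal (Φ s) D y s Tail.xiIotaEven := rfl

/-- `xiIotaDeltaZero`, unfolded. [cite: FitznerVanDerHofstad2017, notebook Percolation.nb cells 43–44 (transcript l.1183–1237)] -/
theorem inpT_xiIotaDeltaZero : (inpT Φ D y s).xiIotaDeltaZero = D.ev s y (XiIota1D0 D.P) + D.ev s y (XiIota3D0 D.P)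
    + (D.ev s y (XiIota0D0 D.P) + D.ev s y (XiIota2D0 D.P))
    + (tailVal (Φ s) D y s Tail.xiIotaOddDeltaZero + tailVal (Φ s) D y s Tail.xiIotaEvenDeltaZero) := rfl

/-- `xiIotaOddDeltaZero`, unfolded. [cite: FitznerVanDerHofstad2017, notebook Percolation.nb cells 43–44 (transcript l.1183–1237)] -/
theorem inpT_xiIotaOddDeltaZero : (inpT Φ D y s).xiIotaOddDeltaZero =
    D.ev s y (XiIota1D0 D.P) + D.ev s y (XiIota3D0 D.P) + tailVal (Φ s) D y s Tail.xiIotaOddDeltaZero := rfl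

/-- `xiIotaEvenDeltaZero`, unfolded. [cite: FitznerVanDerHofstad2017, notebook Percolation.nb cells 43–44 (transcript l.1183–1237)] -/
theorem inpT_xiIotaEvenDeltaZero : (inpT Φ D y s).xiIotaEvenDeltaZero =
    D.ev s y (XiIota0D0 D.P) + D.ev s y (XiIota2D0 D.P) + tailVal (Φ s) D y s Tail.xiIotaEvenDeltaZero := rfl

/-- `xiIotaEvenTailDeltaZero`, unfolded. [cite: FitznerVanDerHofstad2017, notebook Percolation.nb cells 43–44 (transcript l.1183–1237)] -/
theorem inpT_xiIotaEvenTailDeltaZero : (inpT Φ D y s).xiIotaEvenTailDeltaZero =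
    D.ev s y (XiIota2D0 D.P) + tailVal (Φ s) D y s Tail.xiIotaEvenDeltaZero := rfl

/-- `xiIotaDeltaEi`, unfolded. [cite: FitznerVanDerHofstad2017, notebook Percolation.nb cells 43–44 (transcript l.1183–1237)] -/
theorem inpT_xiIotaDeltaEi : (inpT Φ D y s).xiIotaDeltaEi = D.ev s y (XiIota1Dei D.P) + D.ev s y (XiIota3Dei D.P)
    + (D.ev s y (XiIota0Dei D.P) + D.ev s y (XiIota2Dei D.P))
    + (tailVal (Φ s) D y s Tail.xiIotaOddDeltaEi + tailVal (Φ s) D y s Tail.xiIotaEvenDeltaEi) := rfl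

/-- `xiIotaOddDeltaEi`, unfolded. [cite: FitznerVanDerHofstad2017, notebook Percolation.nb cells 43–44 (transcript l.1183–1237)] -/
theorem inpT_xiIotaOddDeltaEi : (inpT Φ D y s).xiIotaOddDeltaEi =
    D.ev s y (XiIota1Dei D.P) + D.ev s y (XiIota3Dei D.P) + tailVal (Φ s) D y s Tail.xiIotaOddDeltaEi := rfl

/-- `xiIotaEvenDeltaEi`, unfolded. [cite: FitznerVanDerHofstad2017, notebook Percolation.nb cells 43–44 (transcript l.1183–1237)] -/
theorem inpT_xiIotaEvenDeltaEi : (inpT Φ D y s).xiIotaEvenDeltaEi =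
    D.ev s y (XiIota0Dei D.P) + D.ev s y (XiIota2Dei D.P) + tailVal (Φ s) D y s Tail.xiIotaEvenDeltaEi := rfl

/-- `xiIotaEvenTailDeltaEi`, unfolded. [cite: FitznerVanDerHofstad2017, notebook Percolation.nb cells 43–44 (transcript l.1183–1237)] -/
theorem inpT_xiIotaEvenTailDeltaEi : (inpT Φ D y s).xiIotaEvenTailDeltaEi =
    D.ev s y (XiIota2Dei D.P) + tailVal (Φ s) D y s Tail.xiIotaEvenDeltaEi := rfl

end Fields

/-! ## Re-association of the four rows and the `Absolut` row -/

section Assoc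

variable {d : ℕ}

/-- From the four rows in the glue's shape (`c₂ + t`, `c₃ + t'`, `c₀ + (c₂ + t)`, `c₁ + (c₃ + t')`) to the record's
shape (`c₀ + c₂ + t`, …) and the interleaved `Absolut` row `(c₁ + c₃) + (c₀ + c₂) + (t' + t)`. [folklore] -/
theorem rows_assoc {Ξ : ℕ → Site d → ℝ} {c₀ c₁ c₂ c₃ t t' : ℝ}
    (hET : NSumLE (fun k x => Ξ (2 * k + 2) x) (c₂ + t)) (hOT : NSumLE (fun k x => Ξ (2 * k + 3) x) (c₃ + t'))
    (hE : NSumLE (fun k x => Ξ (2 * k) x) (c₀ + (c₂ + t)))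
    (hO : NSumLE (fun k x => Ξ (2 * k + 1) x) (c₁ + (c₃ + t'))) :
    NSumLE (fun k x => Ξ (2 * k) x) (c₀ + c₂ + t) ∧
      NSumLE (fun k x => Ξ (2 * k + 1) x) (c₁ + c₃ + t') ∧
      NSumLE (fun k x => Ξ (2 * k + 2) x) (c₂ + t) ∧
      NSumLE (fun k x => Ξ (2 * k + 3) x) (c₃ + t') ∧
      NSumLE Ξ (c₁ + c₃ + (c₀ + c₂) + (t' + t)) := by
  have hA := NSumLE_of_even_odd hE hO
  have e : c₀ + (c₂ + t) + (c₁ + (c₃ + t')) = c₁ + c₃ + (c₀ + c₂) + (t' + t) := by ring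
  rw [e] at hA
  exact ⟨by rw [add_assoc]; exact hE, by rw [add_assoc]; exact hO, hET, hOT, hA⟩

end Assoc

/-! ## The rows at the record `inpFull D y s` -/

section Record

variable {d : ℕ} {ν : Type*} {D : Data ν} {y : State} {s : Pt}

/-- THE PLAIN ROWS `xiEven`, `xiOdd`, `xiEvenTail`, `xiOddTail`, `xiAbs` of Assumption 4.3 at the record with tails,
for a non-negative family `Ξ` (e.g. `Ξ_N = Ξ̂^{(N)}_p`): from the four cells `N ≤ 3`, the Neumann certificate of
`1 − B(s)²`, and the per-`N` bounds `Σ_x Ξ_N(x) ≤ P^S B^{N−1} Ā P^E`, `N ≥ 4` ([FvdH17] (5.34) in the record's block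
coordinates). [cite: FitznerVanDerHofstad2016NoBLE, Assumption 4.3 (4.31) (p. 1086)] [cite: FitznerVanDerHofstad2017, Prop. 5.5 (5.34), Remark 2.3; notebook Percolation.nb cells 41–44 (transcript l.1131–1237)] -/
theorem record_xi_rows {Ξ : ℕ → Site d → ℝ} (h0 : ∀ N x, 0 ≤ Ξ N x)
    (hc₀ : SumLE (Ξ 0) (D.ev s y (Xi0 D.P))) (hc₁ : SumLE (Ξ 1) (D.ev s y (Xi1 D.P)))
    (hc₂ : SumLE (Ξ 2) (D.ev s y (Xi2 D.P))) (hc₃ : SumLE (Ξ 3) (D.ev s y (Xi3 D.P)))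
    (hI : (ingr D s y).Nonneg) {S : Matrix (Fin 3) (Fin 3) ℝ} (hS0 : ∀ i j, 0 ≤ S i j)
    (hS : (1 - (ingr D s y).B * (ingr D s y).B) * S = 1)
    (hN : ∀ N, 4 ≤ N → Summable (Ξ N) ∧ ∑' x, Ξ N x ≤
      (ingr D s y).u .PS ⬝ᵥ (((ingr D s y).B ^ (N - 1) * (ingr D s y).m .AbarNR) *ᵥ (ingr D s y).w .PE)) :
    NSumLE (fun k x => Ξ (2 * k) x) (inpFull D y s).xiEven ∧
      NSumLE (fun k x => Ξ (2 * k + 1) x) (inpFull D y s).xiOdd ∧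
      NSumLE (fun k x => Ξ (2 * k + 2) x) (inpFull D y s).xiEvenTail ∧
      NSumLE (fun k x => Ξ (2 * k + 3) x) (inpFull D y s).xiOddTail ∧
      NSumLE Ξ (inpFull D y s).xiAbs := by
  obtain ⟨hET, hOT, hE, hO, -, -⟩ := NSumLE_rows_of_bounds h0 hc₀ hc₁ hc₂ hc₃ (hI.nn .PS .AbarNR .PE) hS0 hS hN
  rw [← total_xiEven_series] at hET hE
  rw [← total_xiOdd_series] at hOT hO
  rw [inpFull, inpT_xiEven, inpT_xiOdd, inpT_xiEvenTail, inpT_xiOddTail, inpT_xiAbs]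
  exact rows_assoc hET hOT hE hO

/-- THE WEIGHTED ROWS `xiEvenDelta`, `xiOddDelta`, `xiEvenTailDelta`, `xiOddTailDelta`, `xiDeltaAbs` at the record
with tails, for a non-negative family `Ξ` (e.g. `Ξ_N(x) = ‖x‖₂² Ξ̂^{(N)}_p(x)`): from the four `Delta` cells `N ≤ 3`,
the two Neumann certificates, and per-`j` bounds of `Σ_x Ξ_{2j+4}(x)` / `Σ_x Ξ_{2j+5}(x)` by the `j`-th SLICE of the
tables `Tail.xiEvenDelta` / `Tail.xiOddDelta` ([FvdH17] (5.35)/(5.36) regrouped; the slices in the print's coordinates: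
`NobleNSumSliceTables.totalSlice_xiEvenDelta` / `…_xiOddDelta`). [cite: FitznerVanDerHofstad2016NoBLE, Assumption 4.3 (4.32) (p. 1086)] [cite: FitznerVanDerHofstad2017, Prop. 5.5 (5.35)–(5.36), Remark 2.3; notebook Percolation.nb cells 42–44 (transcript l.1161–1237)] -/
theorem record_xiDelta_rows {Ξ : ℕ → Site d → ℝ} (h0 : ∀ N x, 0 ≤ Ξ N x)
    (hc₀ : SumLE (Ξ 0) (D.ev s y (Xi0D D.P))) (hc₁ : SumLE (Ξ 1) (D.ev s y (Xi1D D.P)))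
    (hc₂ : SumLE (Ξ 2) (D.ev s y (Xi2D D.P))) (hc₃ : SumLE (Ξ 3) (D.ev s y (Xi3D D.P)))
    (hI : (ingr D s y).Nonneg) {S Sb : Matrix (Fin 3) (Fin 3) ℝ} (hS0 : ∀ i j, 0 ≤ S i j)
    (hS : (1 - (ingr D s y).B * (ingr D s y).B) * S = 1) (hSb0 : ∀ i j, 0 ≤ Sb i j)
    (hSb : (1 - (ingr D s y).Bb * (ingr D s y).Bb) * Sb = 1)
    (hE : ∀ j, Summable (Ξ (2 * j + 4)) ∧ ∑' x, Ξ (2 * j + 4) x ≤ totalSlice (ingr D s y) Tail.xiEvenDelta j)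
    (hO : ∀ j, Summable (Ξ (2 * j + 5)) ∧ ∑' x, Ξ (2 * j + 5) x ≤ totalSlice (ingr D s y) Tail.xiOddDelta j) :
    NSumLE (fun k x => Ξ (2 * k) x) (inpFull D y s).xiEvenDelta ∧
      NSumLE (fun k x => Ξ (2 * k + 1) x) (inpFull D y s).xiOddDelta ∧
      NSumLE (fun k x => Ξ (2 * k + 2) x) (inpFull D y s).xiEvenTailDelta ∧
      NSumLE (fun k x => Ξ (2 * k + 3) x) (inpFull D y s).xiOddTailDelta ∧
      NSumLE Ξ (inpFull D y s).xiDeltaAbs := by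
  obtain ⟨hET, hOT, hE', hO'⟩ := NSumLE_weightedRows_of_sliceBounds h0 hc₀ hc₁ hc₂ hc₃ hI hS0 hS hSb0 hSb
    Tail.xiEvenDelta Tail.xiOddDelta hE hO
  rw [inpFull, inpT_xiEvenDelta, inpT_xiOddDelta, inpT_xiEvenTailDelta, inpT_xiOddTailDelta, inpT_xiDeltaAbs]
  exact rows_assoc hET hOT hE' hO'

/-- THE `ι`-ROWS `xiIotaEven`, `xiIotaOdd`, `xiIotaEvenTail`, `xiIotaAbs` at the record with tails, for one direction's
non-negative family `Ξ` (e.g. `Ξ_N = Ξ̂^{(N),ι}_p`; the cells do not depend on `ι`): cells `N ≤ 3`, the certificate of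
`1 − B(s)²`, and `Σ_x Ξ_N(x) ≤ P^ι B^{N−1} Ā P^E`, `N ≥ 4` ([FvdH17] (5.37) in the record's block coordinates).  The odd
tail row (no field of `Inputs`) is returned too. [cite: FitznerVanDerHofstad2016NoBLE, Assumption 4.3 (4.31) (p. 1086)] [cite: FitznerVanDerHofstad2017, Prop. 5.6 (5.37), Remark 2.3; notebook Percolation.nb cells 41–44 (transcript l.1131–1237)] -/
theorem record_xiIota_rows {Ξ : ℕ → Site d → ℝ} (h0 : ∀ N x, 0 ≤ Ξ N x)
    (hc₀ : SumLE (Ξ 0) (D.ev s y (XiIota0 D.P))) (hc₁ : SumLE (Ξ 1) (D.ev s y (XiIota1 D.P)))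
    (hc₂ : SumLE (Ξ 2) (D.ev s y (XiIota2 D.P))) (hc₃ : SumLE (Ξ 3) (D.ev s y (XiIota3 D.P)))
    (hI : (ingr D s y).Nonneg) {S : Matrix (Fin 3) (Fin 3) ℝ} (hS0 : ∀ i j, 0 ≤ S i j)
    (hS : (1 - (ingr D s y).B * (ingr D s y).B) * S = 1)
    (hN : ∀ N, 4 ≤ N → Summable (Ξ N) ∧ ∑' x, Ξ N x ≤
      (ingr D s y).u .Piota ⬝ᵥ (((ingr D s y).B ^ (N - 1) * (ingr D s y).m .AbarNR) *ᵥ (ingr D s y).w .PE)) :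
    NSumLE (fun k x => Ξ (2 * k) x) (inpFull D y s).xiIotaEven ∧
      NSumLE (fun k x => Ξ (2 * k + 1) x) (inpFull D y s).xiIotaOdd ∧
      NSumLE (fun k x => Ξ (2 * k + 2) x) (inpFull D y s).xiIotaEvenTail ∧
      NSumLE (fun k x => Ξ (2 * k + 3) x)
        (D.ev s y (XiIota3 D.P) + total Reading.series (ingr D s y) Tail.xiIotaOdd) ∧
      NSumLE Ξ (inpFull D y s).xiIotaAbs := by
  obtain ⟨hET, hOT, hE, hO, -, -⟩ := NSumLE_rows_of_bounds h0 hc₀ hc₁ hc₂ hc₃ (hI.nn .Piota .AbarNR .PE) hS0 hS hN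
  rw [← total_xiIotaEven_series] at hET hE
  rw [← total_xiIotaOdd_series] at hOT hO
  rw [inpFull, inpT_xiIotaEven, inpT_xiIotaOdd, inpT_xiIotaEvenTail, inpT_xiIotaAbs]
  exact rows_assoc hET hOT hE hO

/-- THE WEIGHTED `ι`-ROWS ABOUT `0` (`‖x‖₂²`): `xiIotaEvenDeltaZero`, `xiIotaOddDeltaZero`, `xiIotaEvenTailDeltaZero`,
`xiIotaDeltaZero` at the record with tails, from the four `D0` cells, the two certificates and per-`j` slice bounds
against `Tail.xiIotaEvenDeltaZero` / `Tail.xiIotaOddDeltaZero` ([FvdH17] (5.39)/(5.41) regrouped; slices expanded by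
`NobleNSumSliceTables.totalSlice_xiIotaEvenDeltaZero` / `…OddDeltaZero`).  The odd tail row is returned too.
[cite: FitznerVanDerHofstad2016NoBLE, Assumption 4.3 (4.32) (p. 1086)] [cite: FitznerVanDerHofstad2017, Prop. 5.6 (5.39), (5.41), Remark 2.3; notebook Percolation.nb cells 42–44 (transcript l.1161–1237)] -/
theorem record_xiIotaDeltaZero_rows {Ξ : ℕ → Site d → ℝ} (h0 : ∀ N x, 0 ≤ Ξ N x)
    (hc₀ : SumLE (Ξ 0) (D.ev s y (XiIota0D0 D.P))) (hc₁ : SumLE (Ξ 1) (D.ev s y (XiIota1D0 D.P)))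
    (hc₂ : SumLE (Ξ 2) (D.ev s y (XiIota2D0 D.P))) (hc₃ : SumLE (Ξ 3) (D.ev s y (XiIota3D0 D.P)))
    (hI : (ingr D s y).Nonneg) {S Sb : Matrix (Fin 3) (Fin 3) ℝ} (hS0 : ∀ i j, 0 ≤ S i j)
    (hS : (1 - (ingr D s y).B * (ingr D s y).B) * S = 1) (hSb0 : ∀ i j, 0 ≤ Sb i j)
    (hSb : (1 - (ingr D s y).Bb * (ingr D s y).Bb) * Sb = 1)
    (hE : ∀ j, Summable (Ξ (2 * j + 4)) ∧
      ∑' x, Ξ (2 * j + 4) x ≤ totalSlice (ingr D s y) Tail.xiIotaEvenDeltaZero j)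
    (hO : ∀ j, Summable (Ξ (2 * j + 5)) ∧
      ∑' x, Ξ (2 * j + 5) x ≤ totalSlice (ingr D s y) Tail.xiIotaOddDeltaZero j) :
    NSumLE (fun k x => Ξ (2 * k) x) (inpFull D y s).xiIotaEvenDeltaZero ∧
      NSumLE (fun k x => Ξ (2 * k + 1) x) (inpFull D y s).xiIotaOddDeltaZero ∧
      NSumLE (fun k x => Ξ (2 * k + 2) x) (inpFull D y s).xiIotaEvenTailDeltaZero ∧
      NSumLE (fun k x => Ξ (2 * k + 3) x)
        (D.ev s y (XiIota3D0 D.P) + total Reading.series (ingr D s y) Tail.xiIotaOddDeltaZero) ∧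
      NSumLE Ξ (inpFull D y s).xiIotaDeltaZero := by
  obtain ⟨hET, hOT, hE', hO'⟩ := NSumLE_weightedRows_of_sliceBounds h0 hc₀ hc₁ hc₂ hc₃ hI hS0 hS hSb0 hSb
    Tail.xiIotaEvenDeltaZero Tail.xiIotaOddDeltaZero hE hO
  rw [inpFull, inpT_xiIotaEvenDeltaZero, inpT_xiIotaOddDeltaZero, inpT_xiIotaEvenTailDeltaZero,
    inpT_xiIotaDeltaZero]
  exact rows_assoc hET hOT hE' hO'

/-- THE WEIGHTED `ι`-ROWS ABOUT `e_ι` (`‖x − e_ι‖₂²`): `xiIotaEvenDeltaEi`, `xiIotaOddDeltaEi`, `xiIotaEvenTailDeltaEi`,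
`xiIotaDeltaEi` at the record with tails, from the four `Dei` cells, the two certificates and per-`j` slice bounds
against `Tail.xiIotaEvenDeltaEi` / `Tail.xiIotaOddDeltaEi` ([FvdH17] (5.38)/(5.40) regrouped; slices expanded by
`NobleNSumSliceTables.totalSlice_xiIotaEvenDeltaEi` / `…OddDeltaEi`).  The odd tail row is returned too.
[cite: FitznerVanDerHofstad2016NoBLE, Assumption 4.3 (4.33) (p. 1086)] [cite: FitznerVanDerHofstad2017, Prop. 5.6 (5.38), (5.40), Remark 2.3; notebook Percolation.nb cells 42–44 (transcript l.1161–1237)] -/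
theorem record_xiIotaDeltaEi_rows {Ξ : ℕ → Site d → ℝ} (h0 : ∀ N x, 0 ≤ Ξ N x)
    (hc₀ : SumLE (Ξ 0) (D.ev s y (XiIota0Dei D.P))) (hc₁ : SumLE (Ξ 1) (D.ev s y (XiIota1Dei D.P)))
    (hc₂ : SumLE (Ξ 2) (D.ev s y (XiIota2Dei D.P))) (hc₃ : SumLE (Ξ 3) (D.ev s y (XiIota3Dei D.P)))
    (hI : (ingr D s y).Nonneg) {S Sb : Matrix (Fin 3) (Fin 3) ℝ} (hS0 : ∀ i j, 0 ≤ S i j)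
    (hS : (1 - (ingr D s y).B * (ingr D s y).B) * S = 1) (hSb0 : ∀ i j, 0 ≤ Sb i j)
    (hSb : (1 - (ingr D s y).Bb * (ingr D s y).Bb) * Sb = 1)
    (hE : ∀ j, Summable (Ξ (2 * j + 4)) ∧
      ∑' x, Ξ (2 * j + 4) x ≤ totalSlice (ingr D s y) Tail.xiIotaEvenDeltaEi j)
    (hO : ∀ j, Summable (Ξ (2 * j + 5)) ∧
      ∑' x, Ξ (2 * j + 5) x ≤ totalSlice (ingr D s y) Tail.xiIotaOddDeltaEi j) :
    NSumLE (fun k x => Ξ (2 * k) x) (inpFull D y s).xiIotaEvenDeltaEi ∧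
      NSumLE (fun k x => Ξ (2 * k + 1) x) (inpFull D y s).xiIotaOddDeltaEi ∧
      NSumLE (fun k x => Ξ (2 * k + 2) x) (inpFull D y s).xiIotaEvenTailDeltaEi ∧
      NSumLE (fun k x => Ξ (2 * k + 3) x)
        (D.ev s y (XiIota3Dei D.P) + total Reading.series (ingr D s y) Tail.xiIotaOddDeltaEi) ∧
      NSumLE Ξ (inpFull D y s).xiIotaDeltaEi := by
  obtain ⟨hET, hOT, hE', hO'⟩ := NSumLE_weightedRows_of_sliceBounds h0 hc₀ hc₁ hc₂ hc₃ hI hS0 hS hSb0 hSb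
    Tail.xiIotaEvenDeltaEi Tail.xiIotaOddDeltaEi hE hO
  rw [inpFull, inpT_xiIotaEvenDeltaEi, inpT_xiIotaOddDeltaEi, inpT_xiIotaEvenTailDeltaEi, inpT_xiIotaDeltaEi]
  exact rows_assoc hET hOT hE' hO'

end Record

end Literature.Probability.FitznerVanDerHofstad2017.NobleNSums
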